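/-
Copyright (c) 2026 the pub-hodgecm-mathlib formalisation cell (harness21).  Prover seat hodgecm-mathlib-A-p19 (g21), D-T road (Tamagawa ∕ (K7-s)),
brick B2e-3 «the top-form singular family is an `IsQuotientOf` witness, read on the nose at every framed point» (2026-09-01).
-/
import Literature.NumberTheory.Weil1964.UnitaryArchSingularTopFormFamily
import Literature.NumberTheory.Automorphic.OrbitalMeasureQuotientOfPoint
import HarnessLib

/-!
# The top-form singular family is a Weil-quotient (`IsQuotientOf`) family, read on the nose at every framed point
# (Rogawski 1990 §1.7 p. 6, §4.3 (4.3.1) p. 43; Deitmar–Echterhoff Thm. 1.5.3)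

Topic `NumberTheory/Weil1964`; namespace `Literature.NumberTheory.Weil1964.UnitaryArchTopForm`.  THEOREMS ONLY (no definition, no instance, no notation, no named fact,
no `sorry`) over ★ B2e-2 `UnitaryArchSingularTopFormFamily` (the definition), ★ B2b∕B2d∕B2e-1 (Haar, conjugation coherence, inversion invariance of
`centralizerTopFormHaar`) and ★ `OrbitalMeasureQuotientOfPoint` (`IsQuotientOf.atPoint_eq_quotientMeasure_of_forall_map_conj_eq`).  Cell `pub/hodgecm-mathlib`, crux H413 =
`stmt-HodgeConjecture-24833`; D-T road row «D-T3′», brick B2e.  PURPOSE: the rider (Q-∞) of ★ `Rogawski1990.TamagawaSingularMembersExist` asks for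
`mGis.IsQuotientOf (guard) νi tGi` with `tGi` ∃-bound; here is a NAMED pair `(archSingularTopFormFamily L H ν, centralizerTopFormHaar L H)` satisfying it on the guard «framed»
for EVERY right-invariant `ν` finite on compacts, together with the COHERENT point reading the singular dictionary ★ `ArchSingularOrbitalIntegralDictionary` consumes as `hq`.

* `archSingularTopFormFamily_apply_of_not` — junk `0` off the framed classes.
* **`isQuotientOf_archSingularTopFormFamily`** — `(archSingularTopFormFamily L H ν).IsQuotientOf (fun γ => ∃ frame of γ) ν (centralizerTopFormHaar L H ·)`.
* **`exists_atPoint_archSingularTopFormFamily_eq`** — at every framed `γ` (not only at representatives): `(…).atPoint γ = quotientMeasure Z(γ) (centralizerTopFormHaar L H γ) ν`,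
  with the Haar and inversion-invariance instances ∃-packaged (the `(ti) [IsHaarMeasure ti] [ti.IsInvInvariant] (harch : …)` binder shape of the tower).
HONEST SCOPE.  HC_CM is proved only modulo the printed citations until rung 0 closes; this file discharges no printed statement; the guard «framed» is narrower than (Q-∞)'s
`∃ γ₀, ¬IsRegularElt γ₀ ∧ Corresponds … (γ₀ ⊗ 1) x` (stable conjugates with other block signatures are not framed over `L`).

## References
* J. D. Rogawski, *Automorphic Representations of Unitary Groups in Three Variables*, Ann. of Math. Stud. 123 (1990), §1.7 p. 6, §4.3 (4.3.1) p. 43. [Rogawski1990]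
* A. Deitmar, S. Echterhoff, *Principles of Harmonic Analysis*, 2nd ed. (2014), Thm. 1.5.3. [DeitmarEchterhoff2014]
-/

set_option autoImplicit false

noncomputable section

open NumberField NumberField.mixedEmbedding NumberField.InfinitePlace Set Filter Topology MeasureTheory MeasureTheory.Measure
open Literature.NumberTheory.Automorphic Literature.NumberTheory.Automorphic.UnitaryGroup Literature.NumberTheory.Rogawski1990
open Literature.MeasureTheory.Group
open scoped Classical Matrix MatrixGroups ENNReal NNReal

namespace Literature.NumberTheory.Weil1964

namespace UnitaryArchTopForm

section Quotient

variable (L : Type) [Field L] [NumberField L] [IsCMField L] (H : Matrix (Fin 3) (Fin 3) L)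
  [MeasurableSpace (arch (↥(maximalRealSubfield L)) L (IsCMField.complexConj L) 3 H)] [BorelSpace (arch (↥(maximalRealSubfield L)) L (IsCMField.complexConj L) 3 H)]
  [∀ γ : arch (↥(maximalRealSubfield L)) L (IsCMField.complexConj L) 3 H,
    MeasurableSpace (arch (↥(maximalRealSubfield L)) L (IsCMField.complexConj L) 3 H ⧸
      Subgroup.centralizer ({γ} : Set (arch (↥(maximalRealSubfield L)) L (IsCMField.complexConj L) 3 H)))]
  [∀ γ : arch (↥(maximalRealSubfield L)) L (IsCMField.complexConj L) 3 H,
    BorelSpace (arch (↥(maximalRealSubfield L)) L (IsCMField.complexConj L) 3 H ⧸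
      Subgroup.centralizer ({γ} : Set (arch (↥(maximalRealSubfield L)) L (IsCMField.complexConj L) 3 H)))]

/-- Off the framed classes the family takes the junk value `0`. [cite: Rogawski1990, §4.3 (4.3.1) p. 43] -/
theorem archSingularTopFormFamily_apply_of_not (ν : Measure (arch (↥(maximalRealSubfield L)) L (IsCMField.complexConj L) 3 H)) [IsFiniteMeasureOnCompacts ν]
    [ν.IsMulRightInvariant] (c : ConjClasses (arch (↥(maximalRealSubfield L)) L (IsCMField.complexConj L) 3 H))
    (h : ¬ ∃ (a b : L) (T : GL (Fin 3) (mixedSpace L)) (H_a : Matrix (Fin 2) (Fin 2) L) (H_b : Matrix (Fin 1) (Fin 1) L),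
      IsSingularArchFrame L H (Quotient.out c) a b T H_a H_b) :
    archSingularTopFormFamily L H ν c = 0 := by
  rw [archSingularTopFormFamily_apply, dif_neg h]

/-- **THE TOP-FORM SINGULAR FAMILY IS AN `IsQuotientOf` FAMILY** for the guard «framed» and the NAMED centraliser datum `centralizerTopFormHaar L H`: at every class whose
representative is framed, the datum is Haar (★ `isHaarMeasure_centralizerTopFormHaar`) and inversion invariant (★ `isInvInvariant_centralizerTopFormHaar`) and the member IS the
Weil quotient, by definition. [cite: Rogawski1990, §1.7 p. 6; §4.3 (4.3.1) p. 43] [cite: DeitmarEchterhoff2014, Thm. 1.5.3] -/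
theorem isQuotientOf_archSingularTopFormFamily (ν : Measure (arch (↥(maximalRealSubfield L)) L (IsCMField.complexConj L) 3 H)) [IsFiniteMeasureOnCompacts ν]
    [ν.IsMulRightInvariant] :
    (archSingularTopFormFamily L H ν).IsQuotientOf
      (fun γ => ∃ (a b : L) (T : GL (Fin 3) (mixedSpace L)) (H_a : Matrix (Fin 2) (Fin 2) L) (H_b : Matrix (Fin 1) (Fin 1) L), IsSingularArchFrame L H γ a b T H_a H_b)
      ν (fun γ => centralizerTopFormHaar L H γ) := by
  intro c hc
  refine ⟨isHaarMeasure_centralizerTopFormHaar hc.choose_spec.choose_spec.choose_spec.choose_spec.choose_spec,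
    isInvInvariant_centralizerTopFormHaar hc.choose_spec.choose_spec.choose_spec.choose_spec.choose_spec, ?_⟩
  rw [archSingularTopFormFamily_apply, dif_pos hc]

/-- **THE POINT READING ON THE NOSE**: for every Haar `ν` and every FRAMED `γ ∈ U(H)(L⁺ ⊗ ℝ)` (not only the class representatives), the top-form singular family read at `γ` is
the Weil quotient `dν ∕ d(centralizerTopFormHaar γ)` — ★ `IsQuotientOf.atPoint_eq_quotientMeasure_of_forall_map_conj_eq` fed with the conjugation-stability of frames (★ B2d
`exists_isSingularArchFrame_conj`) and the conjugation coherence of the datum (★ B2d `map_subgroupCongrHomeomorph_conj_centralizerTopFormHaar`); the `∃`-packaged instances are the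
tower's `(ti) [IsHaarMeasure ti] [ti.IsInvInvariant] (harch : m.atPoint γ = quotientMeasure Z(γ) ti _ ν)` binders with `ti := centralizerTopFormHaar L H γ`.
[cite: Rogawski1990, §1.7 p. 6; §4.3 (4.3.1) p. 43] [cite: DeitmarEchterhoff2014, Thm. 1.5.3] -/
theorem exists_atPoint_archSingularTopFormFamily_eq (ν : Measure (arch (↥(maximalRealSubfield L)) L (IsCMField.complexConj L) 3 H)) [ν.IsHaarMeasure] [ν.IsMulRightInvariant]
    (γ : arch (↥(maximalRealSubfield L)) L (IsCMField.complexConj L) 3 H)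
    (hγ : ∃ (a b : L) (T : GL (Fin 3) (mixedSpace L)) (H_a : Matrix (Fin 2) (Fin 2) L) (H_b : Matrix (Fin 1) (Fin 1) L), IsSingularArchFrame L H γ a b T H_a H_b) :
    ∃ (_ : (centralizerTopFormHaar L H γ).IsHaarMeasure) (_ : (centralizerTopFormHaar L H γ).IsInvInvariant),
      (archSingularTopFormFamily L H ν).atPoint γ =
        quotientMeasure (Subgroup.centralizer ({γ} : Set (arch (↥(maximalRealSubfield L)) L (IsCMField.complexConj L) 3 H))) (centralizerTopFormHaar L H γ)
          (isClosed_coe_centralizer_singleton γ) ν :=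
  OrbitalMeasureFamily.IsQuotientOf.atPoint_eq_quotientMeasure_of_forall_map_conj_eq (t := fun γ => centralizerTopFormHaar L H γ)
    (isQuotientOf_archSingularTopFormFamily L H ν) (fun γ₁ q h => exists_isSingularArchFrame_conj γ₁ q h)
    (fun _ _ q hq h => map_subgroupCongrHomeomorph_conj_centralizerTopFormHaar q hq h) γ hγ

end Quotient

end UnitaryArchTopForm

end Literature.NumberTheory.Weil1964

end
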